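import Literature.NumberTheory.EllipticCurves.KubertTateFiveMuDescentSqrtNegTwoMatrix
import Literature.NumberTheory.EllipticCurves.KubertTate1718SqrtNegTwoKummerValues
import Literature.NumberTheory.EllipticCurves.KubertTate1718ShaFive
import Literature.NumberTheory.EllipticCurves.KubertTateFiveGaussianTwistRankZero
import Mathlib.Tactic.NormNum.Prime
import HarnessLib

/-!
# The first `5`-descent over `ℚ(√−2)`: `E_{17/18} ⊗ ℚ(√−2)` has rank `4` and `Ш[5^∞] = 0`
# (so the twist `E_{17/18}^{(−8)}/ℚ` — no rational `5`-torsion, `5` NON-anomalous — has rank `2` and `t₅ = 0`)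

PROOF-ONLY file (theorems only, no definition, no named fact, no `sorry`), topic `NumberTheory/EllipticCurves`; an
INSTANCE of the matrix form of the `5`-isogeny descent of the Kubert–Tate family over `ℚ(√−2)`
(`KubertTateFiveMuDescentSqrtNegTwoMatrix.shaCorank_five_eq_zero_of_matrix_sqrtNegTwo`, `mordellWeilRank_succ_eq_of_matrix_sqrtNegTwo`)
at `(m, n) = (17, 18)`, over ANY number field `K` with `[K : ℚ] = 2` and `θ ∈ K`, `θ² = −2` (tree `SqrtNegTwo.FieldData θ`):

  `E = E_{17/18} = [1, -306, -5508, 0, 0]`, `Δ = -2⁵·3¹⁰·17⁵·19·179`, `rank E(ℚ) = 2`, `t₅(E) = 0` (tree `KubertTate1718ShaFive`);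
  `mn = 2·3²·17` with `3, 17` SPLIT in `ℤ[√−2]` (`3 = (1 + θ)(1 − θ)`, `17 = (3 + 2θ)(3 − 2θ)`), `2 = −θ²` ramified; the curve is
  `ℚ(√−2)`-tame: the bad primes `2, 3, 17, 19, 179` are `≢ 1 (mod 5)` and the two `≡ 4 (mod 5)` ones split
  (`19 ∥ 6² + 2`, `179 ∥ 78² + 2`).

Over `K` the box has FIVE places `(θ), (1 + θ), (1 − θ), (3 + 2θ), (3 − 2θ)` (tree `KubertTate1718SqrtNegTwoDescent.exists_places`)
and is filled by the three `ℚ`-points `−T = (0, 5508)`, `P₁ = (-90, 4950)`, `P₂ = (216, 4320)` together with the two `K`-points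
`R₁ = (-3723/4, (25755 + 184263θ)/8)`, `R₂ = (-1377/4, (23409 + 46818θ)/8)` — the `K`-points attached to the rational points
`u = -3723/4`, `-1377/4` of the twist `-2Y² = g(u)` (a sieved search, seconds): the `5 × 5` matrix of `log`-valuations of the Kummer
values `f_T = xy − 18x² + 324y` relative to `f_T(2T) = 1591812` (§2, from the valuation table of `KubertTate1718SqrtNegTwoValuations`
and the denominator `32 = −θ¹⁰`),

  `M = [[1,1,1,2,2],[0,0,0,3,3],[2,3,3,3,3],[4,1,2,2,4],[4,1,2,0,1]]` (mod `5`),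

is invertible mod `5` (left inverse `[[3,4,4,0,0],[3,1,3,1,3],[0,1,3,4,2],[0,1,0,4,1],[0,1,0,1,4]]`): the `K`-rows differ at the
conjugate places.  Hence, with NO `L`-function, `p`-adic or conjectural input:

* `shaCorank_five_eq_zero` — **`t₅(E_{17/18} ⊗ K) = 0`**; `sha_torsionBy_five_eq_bot` — `Ш(E ⊗ K)[5] = 0`;
* `mordellWeilRank_eq_four` — **`rank E_{17/18}(K) = 4`** (`#E(K)[5] = 5`: no `ζ₅` in a quadratic field);
* sequel `KubertTate1718SqrtNegTwoTwist`: `rank E_{17/18}^{(−8)}(ℚ) = 4 − 2 = 2` and `t₅(E_{17/18}^{(−8)}/ℚ) = 0` — a RANK-TWO curve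
  over `ℚ` without rational `5`-torsion at which `5` (inert in `ℚ(√−2)`) is a good ordinary NON-ANOMALOUS prime (`a₅ = −a₅(E) = −1`).
  Instrument for T = `FiniteShaComponentTransfer` (stmt-22356): the third quadratic field of the twist door.  No `p`-converse
  theorem is in print at rank `2`: nothing here proves T or BSD.

## References

* [SilvermanAEC2009] J. H. Silverman, *AEC*, 2nd ed., Thm. X.4.2, Prop. X.4.9, Exercise 10.1(c), Exercise 10.16, VII.3.1(b).
* [Fisher2001FiveSevenDescent] T. Fisher, JEMS 3 (2001), §§1–2.
* [IrelandRosen1990] K. Ireland, M. Rosen, *A Classical Introduction to Modern Number Theory*, 2nd ed., Ch. 13 §1.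
-/

noncomputable section

open scoped Classical NNReal NumberField AddSubgroup
open WeierstrassCurve WeierstrassCurve.Isogeny Field IsDedekindDomain Ideal
open Literature.NumberTheory.EllipticCurves Literature.NumberTheory.EllipticCurves.KubertTateVelu
  Literature.NumberTheory.EllipticCurves.KubertTateMuDescentNF Literature.NumberTheory.NumberFields
  Literature.NumberTheory.QuadraticFields

namespace Literature.NumberTheory.EllipticCurves

namespace KubertTate1718SqrtNegTwoDescent

variable {K : Type} [Field K] [NumberField K] {θ : K}

/-! ## §1 The curve: `ℚ(√−2)`-tameness, the points over `K` -/

/-- **`ℚ(√−2)`-TAME**: every bad prime `ℓ ∈ {2, 3, 17, 19, 179}` has `ℓ ≢ 1 (mod 5)`, and the two with `ℓ ≡ 4 (mod 5)` split in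
`ℤ[√−2]`: `19 ∥ 6² + 2 = 2·19`, `179 ∥ 78² + 2 = 2·17·179`. [cite: Fisher2001FiveSevenDescent, §2] [cite: IrelandRosen1990, Ch. 13 §1] -/
theorem sqrtNegTwo_tame : ∀ p : ℕ, p.Prime → (p : ℤ) ∣ (kubertTateFive (17 : ℤ) 18).Δ →
    p % 5 ≠ 1 ∧ (p % 5 = 4 → ∃ x : ℤ, (p : ℤ) ∣ x ^ 2 + 2 ∧ ¬ (p : ℤ) ^ 2 ∣ x ^ 2 + 2) := by
  intro p hp hdvd
  refine ⟨KubertTate1718Descent.tame p hp hdvd, fun h4 ↦ ?_⟩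
  rw [KubertTate1718Descent.Δ_int] at hdvd
  have hdvdN : p ∣ 2 ^ 5 * 3 ^ 10 * 17 ^ 5 * 19 * 179 := by
    have h' : (p : ℤ) ∣ ((2 ^ 5 * 3 ^ 10 * 17 ^ 5 * 19 * 179 : ℕ) : ℤ) := by
      have e : ((2 ^ 5 * 3 ^ 10 * 17 ^ 5 * 19 * 179 : ℕ) : ℤ) = 9124598512390176 := by norm_num
      rw [e]; exact (Int.dvd_neg.mpr hdvd)
    exact Int.natCast_dvd_natCast.mp h'
  have hpi := Nat.Prime.prime hp
  rcases hpi.dvd_or_dvd hdvdN with h | h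
  · rcases hpi.dvd_or_dvd h with h | h
    · rcases hpi.dvd_or_dvd h with h | h
      · rcases hpi.dvd_or_dvd h with h | h
        · have := (Nat.prime_dvd_prime_iff_eq hp Nat.prime_two).mp (hpi.dvd_of_dvd_pow h); omega
        · have := (Nat.prime_dvd_prime_iff_eq hp Nat.prime_three).mp (hpi.dvd_of_dvd_pow h); omega
      · have := (Nat.prime_dvd_prime_iff_eq hp (by norm_num : Nat.Prime 17)).mp (hpi.dvd_of_dvd_pow h); omega
    · have := (Nat.prime_dvd_prime_iff_eq hp (by norm_num : Nat.Prime 19)).mp h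
      subst this
      exact ⟨6, by norm_num, by norm_num⟩
  · have := (Nat.prime_dvd_prime_iff_eq hp (by norm_num : Nat.Prime 179)).mp h
    subst this
    exact ⟨78, by norm_num, by norm_num⟩

/-- `E_{17/18} ⊗ K` is elliptic. [cite: Kubert1976, Table 3 (N = 5)] -/
theorem isElliptic : (kubertTateFive ((17 : ℤ) : K) ((18 : ℤ) : K)).IsElliptic :=
  haveI := KubertTate1718Descent.isElliptic
  KubertTateGaussianTwist.isElliptic_base (K := K) 17 18

/-- The three `ℚ`-points `−T = (0, 5508)`, `P₁ = (-90, 4950)`, `P₂ = (216, 4320)`, the two `K`-points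
`R₁ = (-3723/4, (25755 + 184263θ)/8)`, `R₂ = (-1377/4, (23409 + 46818θ)/8)` and the base point `2T = (306, 5202)` lie on `E_{17/18} ⊗ K`
(`θ² = −2`). [cite: Fisher2001FiveSevenDescent, §2 (the family; these points verified in-file)] -/
theorem nonsingular_points (hK : SqrtNegTwo.FieldData θ) :
    (kubertTateFive ((17 : ℤ) : K) ((18 : ℤ) : K)).toAffine.Nonsingular 0 5508 ∧
    (kubertTateFive ((17 : ℤ) : K) ((18 : ℤ) : K)).toAffine.Nonsingular (-90) 4950 ∧
    (kubertTateFive ((17 : ℤ) : K) ((18 : ℤ) : K)).toAffine.Nonsingular 216 4320 ∧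
    (kubertTateFive ((17 : ℤ) : K) ((18 : ℤ) : K)).toAffine.Nonsingular (-3723/4 : K) (((25755 : K) + 184263 * θ) / 8) ∧
    (kubertTateFive ((17 : ℤ) : K) ((18 : ℤ) : K)).toAffine.Nonsingular (-1377/4 : K) (((23409 : K) + 46818 * θ) / 8) ∧
    (kubertTateFive ((17 : ℤ) : K) ((18 : ℤ) : K)).toAffine.Nonsingular 306 5202 := by
  haveI := isElliptic (K := K)
  have hsq := hK.sq_eq
  refine ⟨?_, ?_, ?_, ?_, ?_, ?_⟩ <;>
    rw [← Affine.equation_iff_nonsingular, KubertTateMuDescentNF.equation_iff_base (K := K) 17 18] <;> push_cast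
  · norm_num
  · norm_num
  · norm_num
  · linear_combination ((184263 : K) ^ 2 / 64) * hsq
  · linear_combination ((46818 : K) ^ 2 / 64) * hsq
  · norm_num

/-- `P₁ = (-90, 4950) ∈ E(ℚ)` (reference point of the `μ₅`-side). [cite: SilvermanAEC2009, VIII.§1] -/
theorem nonsingular_P₁_rat :
    (kubertTateFive (((17 : ℤ) : ℚ)) (((18 : ℤ) : ℚ))).toAffine.Nonsingular (-90) 4950 :=
  (KubertTate1718Descent.nonsingular_iff _ _).mpr (by norm_num)

/-! ## §2 (The `log`-valuation table of the five Kummer values is `KubertTate1718SqrtNegTwoKummerValues.log_valuation_points`.) -/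

/-! ## §3 Two places over different rational primes are distinct -/

omit [NumberField K] in
/-- Places above different rational primes are different. [cite: IrelandRosen1990, Ch. 13 §1] -/
private theorem ne_of_natCast_mem {v w : HeightOneSpectrum (𝓞 K)} {ℓ ℓ' : ℕ} (hℓ : ℓ.Prime) (hℓ' : ℓ'.Prime)
    (hne : ℓ ≠ ℓ') (h : (ℓ : 𝓞 K) ∈ v.asIdeal) (h' : (ℓ' : 𝓞 K) ∈ w.asIdeal) : v ≠ w := by
  rintro rfl
  have hd := natCast_dvd_of_intCast_mem hℓ h (d := ℓ') (by rw [Int.cast_natCast]; exact h')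
  exact hne ((Nat.prime_dvd_prime_iff_eq hℓ hℓ').mp (Int.natCast_dvd_natCast.mp hd))

/-- Conjugate places above a split prime are different: if `π, π̄ ∈ v` with `π + π̄ = s ∈ ℤ` and `ℓ ∈ v`, `gcd(s, ℓ) = 1`, contradiction.
Here: `(1 + θ) + (1 − θ) = 2` with `3 ∈ v`, and `(3 + 2θ) + (3 − 2θ) = 6` with `17 ∈ v`. [cite: IrelandRosen1990, Ch. 13 §1] -/
private theorem ne_of_sum_mem (hK : SqrtNegTwo.FieldData θ) {v w : HeightOneSpectrum (𝓞 K)} {z z' : ℤ√(-2)} {s a b : ℤ} {ℓ : ℕ}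
    (hzz : z + z' = (s : ℤ√(-2))) (hab : a * s + b * ℓ = 1)
    (hv : v.asIdeal = span {hK.ringEquiv z}) (hw : w.asIdeal = span {hK.ringEquiv z'}) (hℓ : (ℓ : 𝓞 K) ∈ v.asIdeal) : v ≠ w := by
  rintro rfl
  have hz : hK.ringEquiv z ∈ v.asIdeal := by rw [hv]; exact mem_span_singleton_self _
  have hz' : hK.ringEquiv z' ∈ v.asIdeal := by rw [hw]; exact mem_span_singleton_self _
  have hs : (s : 𝓞 K) ∈ v.asIdeal := by
    rw [← hK.ringEquiv_intCast, ← hzz, map_add]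
    exact v.asIdeal.add_mem hz hz'
  apply v.isPrime.ne_top
  rw [Ideal.eq_top_iff_one]
  have e : (1 : 𝓞 K) = (a : 𝓞 K) * s + (b : 𝓞 K) * ℓ := by exact_mod_cast congrArg (fun t : ℤ ↦ (t : 𝓞 K)) hab.symm
  rw [e]
  exact v.asIdeal.add_mem (v.asIdeal.mul_mem_left _ hs) (v.asIdeal.mul_mem_left _ hℓ)

/-! ## §4 The descent over `K = ℚ(√−2)`: box full at five places -/

/-- **The complete `5`-descent of `E_{17/18}` over `K = ℚ(√−2)`**: `t₅(E ⊗ K) = 0`, `Ш(E ⊗ K)[5] = 0` and `rank E(K) + 1 = 5`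
(box of five places filled by three `ℚ`-points and two `K`-points; matrix invertible mod `5`).
[cite: SilvermanAEC2009, Thm. X.4.2(a) and Thm. X.1.1] [cite: Fisher2001FiveSevenDescent, §2] -/
theorem descent (hK : SqrtNegTwo.FieldData θ) :
    haveI := isElliptic (K := K)
    (kubertTateFive ((17 : ℤ) : K) ((18 : ℤ) : K)).shaCorank 5 = 0 ∧
      (kubertTateFive ((17 : ℤ) : K) ((18 : ℤ) : K)).sha[((5 : ℕ) : ℤ)] = ⊥ ∧
      (kubertTateFive ((17 : ℤ) : K) ((18 : ℤ) : K)).mordellWeilRank + 1 = 5 := by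
  haveI := isElliptic (K := K)
  haveI := KubertTate1718Descent.isElliptic
  haveI : Fact (Nat.Prime 7) := ⟨by norm_num⟩
  obtain ⟨v₀, v₁, v₂, v₃, v₄, hv₀, hv₁, hv₂, hv₃, hv₄⟩ := exists_places hK
  obtain ⟨hℓ₀, hℓ₁, hℓ₂, hℓ₃, hℓ₄⟩ := natCast_mem_places hK hv₀ hv₁ hv₂ hv₃ hv₄
  obtain ⟨p₀, p₁, p₂, p₃, p₄⟩ := prime_gens hK
  have hπ₀ : hK.ringEquiv ⟨0, 1⟩ ∈ v₀.asIdeal := by rw [hv₀]; exact mem_span_singleton_self _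
  have hπ₁ : hK.ringEquiv ⟨1, 1⟩ ∈ v₁.asIdeal := by rw [hv₁]; exact mem_span_singleton_self _
  have hπ₂ : hK.ringEquiv ⟨1, -1⟩ ∈ v₂.asIdeal := by rw [hv₂]; exact mem_span_singleton_self _
  have hπ₃ : hK.ringEquiv ⟨3, 2⟩ ∈ v₃.asIdeal := by rw [hv₃]; exact mem_span_singleton_self _
  have hπ₄ : hK.ringEquiv ⟨3, -2⟩ ∈ v₄.asIdeal := by rw [hv₄]; exact mem_span_singleton_self _
  -- distinctness of the five places
  have h01 : v₀ ≠ v₁ := ne_of_natCast_mem Nat.prime_two (by norm_num) (by norm_num) hℓ₀ hℓ₁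
  have h02 : v₀ ≠ v₂ := ne_of_natCast_mem Nat.prime_two (by norm_num) (by norm_num) hℓ₀ hℓ₂
  have h03 : v₀ ≠ v₃ := ne_of_natCast_mem Nat.prime_two (by norm_num) (by norm_num) hℓ₀ hℓ₃
  have h04 : v₀ ≠ v₄ := ne_of_natCast_mem Nat.prime_two (by norm_num) (by norm_num) hℓ₀ hℓ₄
  have h13 : v₁ ≠ v₃ := ne_of_natCast_mem (by norm_num) (by norm_num) (by norm_num) hℓ₁ hℓ₃
  have h14 : v₁ ≠ v₄ := ne_of_natCast_mem (by norm_num) (by norm_num) (by norm_num) hℓ₁ hℓ₄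
  have h23 : v₂ ≠ v₃ := ne_of_natCast_mem (by norm_num) (by norm_num) (by norm_num) hℓ₂ hℓ₃
  have h24 : v₂ ≠ v₄ := ne_of_natCast_mem (by norm_num) (by norm_num) (by norm_num) hℓ₂ hℓ₄
  have h12 : v₁ ≠ v₂ := ne_of_sum_mem hK (z := ⟨1, 1⟩) (z' := ⟨1, -1⟩) (s := 2) (a := -1) (b := 1) (ℓ := 3)
    (by decide) (by norm_num) hv₁ hv₂ hℓ₁
  have h34 : v₃ ≠ v₄ := ne_of_sum_mem hK (z := ⟨3, 2⟩) (z' := ⟨3, -2⟩) (s := 6) (a := 3) (b := -1) (ℓ := 17)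
    (by decide) (by norm_num) hv₃ hv₄ hℓ₃
  have hpl : Function.Injective ![v₀, v₁, v₂, v₃, v₄] := by
    intro i j h
    fin_cases i <;> fin_cases j
    · rfl
    · exact absurd h h01
    · exact absurd h h02
    · exact absurd h h03
    · exact absurd h h04
    · exact absurd h h01.symm
    · rfl
    · exact absurd h h12
    · exact absurd h h13
    · exact absurd h h14
    · exact absurd h h02.symm
    · exact absurd h h12.symm
    · rfl
    · exact absurd h h23
    · exact absurd h h24
    · exact absurd h h03.symm
    · exact absurd h h13.symm
    · exact absurd h h23.symm
    · rfl
    · exact absurd h h34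
    · exact absurd h h04.symm
    · exact absurd h h14.symm
    · exact absurd h h24.symm
    · exact absurd h h34.symm
    · rfl
  -- the support: off the five places, `17 = (3 + 2θ)(3 − 2θ)` and `18 = -θ²(1 + θ)(1 − θ)·(1 + θ)(1 − θ)/…` are units
  have hS : ∀ v : HeightOneSpectrum (𝓞 K), (∀ j, ![v₀, v₁, v₂, v₃, v₄] j ≠ v) →
      (((17 : ℤ) : ℤ) : 𝓞 K) ∉ v.asIdeal ∧ (((18 : ℤ) : ℤ) : 𝓞 K) ∉ v.asIdeal := by
    intro v hv
    have n0 : v₀ ≠ v := hv 0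
    have n1 : v₁ ≠ v := hv 1
    have n2 : v₂ ≠ v := hv 2
    have n3 : v₃ ≠ v := hv 3
    have n4 : v₄ ≠ v := hv 4
    have hP := v.isPrime
    constructor
    · intro h17mem
      have e : (((17 : ℤ) : ℤ) : 𝓞 K) = hK.ringEquiv ⟨3, 2⟩ * hK.ringEquiv ⟨3, -2⟩ := by
        rw [← map_mul, ← hK.ringEquiv_intCast]; exact congrArg hK.ringEquiv (by decide)
      rw [e] at h17mem
      rcases hP.mem_or_mem h17mem with h | h
      · exact n3 (eq_of_mem_of_mem_of_prime p₃ hπ₃ h)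
      · exact n4 (eq_of_mem_of_mem_of_prime p₄ hπ₄ h)
    · intro h18mem
      have e : (((18 : ℤ) : ℤ) : 𝓞 K) = (hK.ringEquiv ⟨0, 1⟩ * hK.ringEquiv ⟨0, 1⟩) *
          ((hK.ringEquiv ⟨1, 1⟩ * hK.ringEquiv ⟨1, -1⟩) * (hK.ringEquiv ⟨-1, -1⟩ * hK.ringEquiv ⟨1, -1⟩)) := by
        rw [← map_mul, ← map_mul, ← map_mul, ← map_mul, ← map_mul, ← hK.ringEquiv_intCast]
        exact congrArg hK.ringEquiv (by decide)
      rw [e] at h18mem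
      rcases hP.mem_or_mem h18mem with h | h
      · rcases hP.mem_or_mem h with h | h
        · exact n0 (eq_of_mem_of_mem_of_prime p₀ hπ₀ h)
        · exact n0 (eq_of_mem_of_mem_of_prime p₀ hπ₀ h)
      · rcases hP.mem_or_mem h with h | h
        · rcases hP.mem_or_mem h with h | h
          · exact n1 (eq_of_mem_of_mem_of_prime p₁ hπ₁ h)
          · exact n2 (eq_of_mem_of_mem_of_prime p₂ hπ₂ h)
        · rcases hP.mem_or_mem h with h | h
          · -- `-(1 + θ) ∈ v` ⟹ `1 + θ ∈ v`
            have h' : hK.ringEquiv ⟨1, 1⟩ ∈ v.asIdeal := by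
              have e' : hK.ringEquiv ⟨1, 1⟩ = -hK.ringEquiv ⟨-1, -1⟩ := by
                rw [← map_neg]; exact congrArg hK.ringEquiv (by decide)
              rw [e']; exact v.asIdeal.neg_mem h
            exact n1 (eq_of_mem_of_mem_of_prime p₁ hπ₁ h')
          · exact n2 (eq_of_mem_of_mem_of_prime p₂ hπ₂ h)
  -- the points
  obtain ⟨hn0, hn1, hn2, hn3, hn4, hnb⟩ := nonsingular_points hK
  have hxy : ∀ i : Fin 5, ¬ (![(0 : K), -90, 216, (-3723/4 : K), (-1377/4 : K)] i = 0 ∧ ![(5508 : K), 4950, 4320, ((25755 : K) + 184263 * θ) / 8, ((23409 : K) + 46818 * θ) / 8] i = 0) := by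
    intro i
    fin_cases i
    · simp only [Fin.zero_eta, Matrix.cons_val_zero]; norm_num
    · simp only [Fin.mk_one, Matrix.cons_val_one, Matrix.cons_val_zero]; norm_num
    · simp only [Fin.reduceFinMk, Matrix.cons_val]; norm_num
    · simp only [Fin.reduceFinMk, Matrix.cons_val]; norm_num
    · simp only [Fin.reduceFinMk, Matrix.cons_val]; norm_num
  -- the Kummer values as elements of `ℤ[√−2]` (over `32` for the two `K`-points)
  have hf : ∀ i : Fin 5, ((![(0 : K), -90, 216, (-3723/4 : K), (-1377/4 : K)] i) * (![(5508 : K), 4950, 4320, ((25755 : K) + 184263 * θ) / 8, ((23409 : K) + 46818 * θ) / 8] i) -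
            ((18 : ℤ) : K) * (![(0 : K), -90, 216, (-3723/4 : K), (-1377/4 : K)] i) ^ 2 +
            ((18 : ℤ) : K) ^ 2 * (![(5508 : K), 4950, 4320, ((25755 : K) + 184263 * θ) / 8, ((23409 : K) + 46818 * θ) / 8] i)) =
      (![((hK.ringEquiv ⟨1784592, 0⟩ : 𝓞 K) : K), ((hK.ringEquiv ⟨1012500, 0⟩ : 𝓞 K) : K), ((hK.ringEquiv ⟨1492992, 0⟩ : 𝓞 K) : K), ((hK.ringEquiv ⟨-561493629, -447206301⟩ : 𝓞 K) : K) / 32, ((hK.ringEquiv ⟨-70156773, -3792258⟩ : 𝓞 K) : K) / 32] i) := by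
    intro i
    fin_cases i
    · simp only [Fin.zero_eta, Matrix.cons_val_zero, hK.coe_ringEquiv]
      push_cast; ring
    · simp only [Fin.mk_one, Matrix.cons_val_one, Matrix.cons_val_zero, hK.coe_ringEquiv]
      push_cast; ring
    · simp only [Fin.reduceFinMk, Matrix.cons_val, hK.coe_ringEquiv]
      push_cast; ring
    · simp only [Fin.reduceFinMk, Matrix.cons_val, hK.coe_ringEquiv]
      push_cast; ring
    · simp only [Fin.reduceFinMk, Matrix.cons_val, hK.coe_ringEquiv]
      push_cast; ring
  have hfb : ((306 : K) * 5202 - ((18 : ℤ) : K) * 306 ^ 2 + ((18 : ℤ) : K) ^ 2 * 5202) =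
      (((hK.ringEquiv ⟨1591812, 0⟩ : 𝓞 K) : 𝓞 K) : K) := by
    rw [hK.coe_ringEquiv]; push_cast; ring
  -- the matrix and its inverse mod 5
  have hmat : Matrix.of (fun i j : Fin 5 ↦
      ((WithZero.log ((![v₀, v₁, v₂, v₃, v₄] j).valuation K
          ((![(0 : K), -90, 216, (-3723/4 : K), (-1377/4 : K)] i) * (![(5508 : K), 4950, 4320, ((25755 : K) + 184263 * θ) / 8, ((23409 : K) + 46818 * θ) / 8] i) -
            ((18 : ℤ) : K) * (![(0 : K), -90, 216, (-3723/4 : K), (-1377/4 : K)] i) ^ 2 +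
            ((18 : ℤ) : K) ^ 2 * (![(5508 : K), 4950, 4320, ((25755 : K) + 184263 * θ) / 8, ((23409 : K) + 46818 * θ) / 8] i))) -
        WithZero.log ((![v₀, v₁, v₂, v₃, v₄] j).valuation K
          ((306 : K) * 5202 - ((18 : ℤ) : K) * 306 ^ 2 + ((18 : ℤ) : K) ^ 2 * 5202)) : ℤ) : ZMod 5)) =
      !![1, 1, 1, 2, 2; 0, 0, 0, 3, 3; 2, 3, 3, 3, 3; 4, 1, 2, 2, 4; 4, 1, 2, 0, 1] := by
    ext i j
    simp only [Matrix.of_apply]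
    rw [hf i, hfb, log_valuation_points hK hv₀ hv₁ hv₂ hv₃ hv₄ i j, log_valuation_base hK hv₀ hv₁ hv₂ hv₃ hv₄ j]
    fin_cases i <;> fin_cases j <;> decide
  have hinv : (!![3, 4, 4, 0, 0; 3, 1, 3, 1, 3; 0, 1, 3, 4, 2; 0, 1, 0, 4, 1; 0, 1, 0, 1, 4] : Matrix (Fin 5) (Fin 5) (ZMod 5)) *
      !![1, 1, 1, 2, 2; 0, 0, 0, 3, 3; 2, 3, 3, 3, 3; 4, 1, 2, 2, 4; 4, 1, 2, 0, 1] = 1 := by decide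
  have hM : ∀ e : Fin 5 → ZMod 5, ∃ c : Fin 5 → ZMod 5, Matrix.vecMul c (Matrix.of (fun i j : Fin 5 ↦
      ((WithZero.log ((![v₀, v₁, v₂, v₃, v₄] j).valuation K
          ((![(0 : K), -90, 216, (-3723/4 : K), (-1377/4 : K)] i) * (![(5508 : K), 4950, 4320, ((25755 : K) + 184263 * θ) / 8, ((23409 : K) + 46818 * θ) / 8] i) -
            ((18 : ℤ) : K) * (![(0 : K), -90, 216, (-3723/4 : K), (-1377/4 : K)] i) ^ 2 +
            ((18 : ℤ) : K) ^ 2 * (![(5508 : K), 4950, 4320, ((25755 : K) + 184263 * θ) / 8, ((23409 : K) + 46818 * θ) / 8] i))) -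
        WithZero.log ((![v₀, v₁, v₂, v₃, v₄] j).valuation K
          ((306 : K) * 5202 - ((18 : ℤ) : K) * 306 ^ 2 + ((18 : ℤ) : K) ^ 2 * 5202)) : ℤ) : ZMod 5))) = e := by
    intro e
    refine ⟨Matrix.vecMul e !![3, 4, 4, 0, 0; 3, 1, 3, 1, 3; 0, 1, 3, 4, 2; 0, 1, 0, 4, 1; 0, 1, 0, 1, 4], ?_⟩
    rw [hmat, Matrix.vecMul_vecMul, hinv, Matrix.vecMul_one]
  -- the reference point `P₁ = (-90, 4950)`, `25 P₁ ≠ O` transported from `ℚ` (good prime `7`)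
  have h25 := KubertTateGaussianTwist.twentyfive_zsmul_toGeomPoints_cast_ne_zero (K := K) 17 18 nonsingular_P₁_rat
    (by norm_num) (by norm_num) 7 (by norm_num) (by norm_num) KubertTate1718Descent.not_tor_dvd_Δ
  refine ⟨?_, ?_, ?_⟩
  · exact KubertTateMuDescentNF.shaCorank_five_eq_zero_of_matrix_sqrtNegTwo 17 18 _ (fun σ ↦ smul_toGeomPoints _ σ _) h25 hK
      KubertTate1718Descent.not_five_dvd_Δ sqrtNegTwo_tame ![v₀, v₁, v₂, v₃, v₄] hpl hS
      ![(0 : K), -90, 216, (-3723/4 : K), (-1377/4 : K)]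
      ![(5508 : K), 4950, 4320, ((25755 : K) + 184263 * θ) / 8, ((23409 : K) + 46818 * θ) / 8]
      (fun i ↦ by fin_cases i <;> assumption) hxy
      306 5202 hnb (by norm_num) hM
  · exact KubertTateMuDescentNF.sha_torsionBy_five_eq_bot_of_matrix_sqrtNegTwo 17 18 _ (fun σ ↦ smul_toGeomPoints _ σ _) h25 hK
      KubertTate1718Descent.not_five_dvd_Δ sqrtNegTwo_tame ![v₀, v₁, v₂, v₃, v₄] hpl hS
      ![(0 : K), -90, 216, (-3723/4 : K), (-1377/4 : K)]
      ![(5508 : K), 4950, 4320, ((25755 : K) + 184263 * θ) / 8, ((23409 : K) + 46818 * θ) / 8]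
      (fun i ↦ by fin_cases i <;> assumption) hxy
      306 5202 hnb (by norm_num) hM
  · exact KubertTateMuDescentNF.mordellWeilRank_succ_eq_of_matrix_sqrtNegTwo 17 18 _ (fun σ ↦ smul_toGeomPoints _ σ _) h25 hK
      KubertTate1718Descent.not_five_dvd_Δ sqrtNegTwo_tame ![v₀, v₁, v₂, v₃, v₄] hpl hS
      ![(0 : K), -90, 216, (-3723/4 : K), (-1377/4 : K)]
      ![(5508 : K), 4950, 4320, ((25755 : K) + 184263 * θ) / 8, ((23409 : K) + 46818 * θ) / 8]
      (fun i ↦ by fin_cases i <;> assumption) hxy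
      306 5202 hnb (by norm_num) hM

/-! ## §5 The theorems -/

/-- **`t₅(E_{17/18} ⊗ ℚ(√−2)) = corank_{ℤ₅} Ш(E_{17/18}/ℚ(√−2))[5^∞] = 0`, UNCONDITIONALLY**, by the complete `5`-descent over
`ℚ(√−2)` at five places (two pairs of conjugate split primes). [cite: SilvermanAEC2009, Thm. X.4.2(a)] [cite: Fisher2001FiveSevenDescent, §2] -/
theorem shaCorank_five_eq_zero (hK : SqrtNegTwo.FieldData θ) :
    haveI := isElliptic (K := K)
    (kubertTateFive ((17 : ℤ) : K) ((18 : ℤ) : K)).shaCorank 5 = 0 := (descent hK).1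

/-- **`Ш(E_{17/18}/ℚ(√−2))[5] = 0`, unconditionally.** [cite: SilvermanAEC2009, Thm. X.4.2(a)] -/
theorem sha_torsionBy_five_eq_bot (hK : SqrtNegTwo.FieldData θ) :
    haveI := isElliptic (K := K)
    (kubertTateFive ((17 : ℤ) : K) ((18 : ℤ) : K)).sha[((5 : ℕ) : ℤ)] = ⊥ := (descent hK).2.1

/-- **`rank E_{17/18}(ℚ(√−2)) = 4`, unconditionally** (the descent over `ℚ(√−2)` computes the rank: box of five places full,
`#E(K)[5] = 5`). [cite: SilvermanAEC2009, Thm. X.4.2 and Thm. X.1.1] -/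
theorem mordellWeilRank_eq_four (hK : SqrtNegTwo.FieldData θ) :
    haveI := isElliptic (K := K)
    (kubertTateFive ((17 : ℤ) : K) ((18 : ℤ) : K)).mordellWeilRank = 4 := by
  have h := (descent hK).2.2
  omega

end KubertTate1718SqrtNegTwoDescent

end Literature.NumberTheory.EllipticCurves

end
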